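import Summits.MatrixMultiplication.MatrixMultiplication.Theorems.SoloInformedNearRectDegenerate
import Summits.MatrixMultiplication.MatrixMultiplication.Theorems.SoloInformedZeroRigidity

/-!
# THEOREM 8.19, numerical ending: a heavy near-rectangle box forces `n³ ≤ 12·c_I·c_L·c_K · (r·|S⁰|)`

This work, §8.8 (T13) and C3-m2 §5.5–5.7 (gen 108: the kernel glue). Setting: a CU13-Def-12 realization of
`⟨n,n,n⟩` in `𝒮(S⁰ × S¹, ±)` [CohnUmans2013, arXiv:1207.6528, Def. 12] — equation data `D : Data ι G`
(no 2-torsion), a chart `Φ`, full separation, class map `κ : G → R`, `M := |R|·|S⁰| = r·|S⁰|`.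

`Data.box_ending`: a box `I₀ × 𝓛 × K₀` with `a ≈ [v′]` on `I₀ × 𝓛` and `b ≈ [v]` on `𝓛 × K₀` (at most `e`
exceptional cells per line, in both directions), whose three sides are heavy (`n ≤ c_I|I₀|`, `n ≤ c_L|𝓛|`,
`n ≤ c_K|K₀|`) and whose exception budget is small (`36·c_I c_L c_K·(e+1) ≤ n`), gives
`n³ ≤ 12·c_I c_L c_K·M` — in EVERY class configuration: `v′ = 0` (`Data.card_mul_le_of_a_nearZero`),
`v = 0` (`Data.sq_mul_min_le_of_b_nearZero`), `v ∼ v′` (`Data.nearRect_signEq`) and the generic one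
(`Data.nearRect`). The structural trichotomy `K₀ = K_c ⊔ K₊ ⊔ K₋` is turned into numbers once and for all here
(`BoxArith.*`): one of the three parts carries a third of `K₀`; on `K_c` (T2a) ends, on `K_±` the 8.18 box count
`|I₁||𝓛||K_±| ≤ |S⁰| + 3e·n²` ends, on the zero-pinned part the rigid rectangle ends.
-/

namespace Summit.MatrixMultiplication.MatrixMultiplication.Theorems.TwistedTPP

namespace FibreLines

namespace BoxArith

/-- `c·m ≤ n ≤ c·X` with `c ≤ C`, `C·m ≤ n`, `0 < c` gives `m ≤ X`. -/
theorem le_of_mul_le (n c C m X : ℕ) (hc : 0 < c) (hcC : c ≤ C) (hX : n ≤ c * X) (he : C * m ≤ n) :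
    m ≤ X :=
  Nat.le_of_mul_le_mul_left (le_trans (le_trans (Nat.mul_le_mul_right m hcC) he) hX) hc

/-- `c ≤ c·c′·c″` for positive `c′, c″` (three placements). -/
theorem le_prod₃ (cI cL cK : ℕ) (hcI : 1 ≤ cI) (hcL : 1 ≤ cL) (hcK : 1 ≤ cK) :
    cI ≤ cI * cL * cK ∧ cL ≤ cI * cL * cK ∧ cK ≤ cI * cL * cK := by
  refine ⟨?_, ?_, ?_⟩
  · calc cI = cI * 1 * 1 := by ring
      _ ≤ cI * cL * cK := Nat.mul_le_mul (Nat.mul_le_mul_left _ hcL) hcK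
  · calc cL = 1 * cL * 1 := by ring
      _ ≤ cI * cL * cK := Nat.mul_le_mul (Nat.mul_le_mul_right _ hcI) hcK
  · calc cK = 1 * 1 * cK := by ring
      _ ≤ cI * cL * cK := Nat.mul_le_mul_right _ (Nat.mul_le_mul hcI hcL)

/-- The third part of a trichotomy of a heavy set is heavy. -/
theorem third_heavy (n cK K Kc Kp Km : ℕ) (hK : n ≤ cK * K) (hcard : K = Kc + Kp + Km)
    (h1 : ¬ n ≤ 3 * cK * Kc) (h2 : ¬ n ≤ 3 * cK * Kp) : n ≤ 3 * cK * Km := by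
  subst hcard
  push Not at h1 h2
  nlinarith [h1, h2, hK]

/-- `n ≤ c_I|I₀|`, `|I₀| ≤ |I₁| + 2e`, `4c_I e ≤ n` give `n ≤ 2c_I|I₁|`. -/
theorem le_two_mul (n cI I₀ I₁ e : ℕ) (hI : n ≤ cI * I₀) (hI₁ : I₀ ≤ I₁ + 2 * e)
    (h4 : 4 * cI * e ≤ n) : n ≤ 2 * cI * I₁ := by
  have h := Nat.mul_le_mul_left cI hI₁
  nlinarith [h]

/-- `36·C·e ≤ n`, `c_I ≤ C` give `4c_I e ≤ n`. -/
theorem four_mul_le (n e cI C : ℕ) (hCI : cI ≤ C) (he : 36 * C * e ≤ n) : 4 * cI * e ≤ n := by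
  have h := Nat.mul_le_mul_right e hCI
  nlinarith [h]

/-- Ending on the class-constant part `K_c`: `n·|K_c|·|𝓛| ≤ M`, `3c_K|K_c| ≥ n`, `c_L|𝓛| ≥ n`. -/
theorem cube_le_of_kc (n M Kc L cI cL cK : ℕ) (hL : n ≤ cL * L) (hK : n ≤ 3 * cK * Kc)
    (hb : n * Kc * L ≤ M) (hcI : 1 ≤ cI) : n ^ 3 ≤ 12 * (cI * cL * cK) * M := by
  have h1 : n ^ 3 ≤ 3 * (cL * cK) * (n * Kc * L) := by
    calc n ^ 3 = n * n * n := by ring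
      _ ≤ n * (3 * cK * Kc) * (cL * L) := Nat.mul_le_mul (Nat.mul_le_mul_left _ hK) hL
      _ = 3 * (cL * cK) * (n * Kc * L) := by ring
  have h2 : 3 * (cL * cK) * (n * Kc * L) ≤ 3 * (cL * cK) * M := Nat.mul_le_mul_left _ hb
  have h3 : 3 * (cL * cK) * M ≤ 12 * (cI * cL * cK) * M := by
    apply Nat.mul_le_mul_right
    nlinarith [Nat.zero_le (cL * cK)]
  omega

/-- Ending on a pinned part `K_±`: the 8.18 box count plus heaviness of the three sides. -/
theorem cube_le_of_part (n M G0 I₀ I₁ L Kp e cI cL cK : ℕ)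
    (hI : n ≤ cI * I₀) (hL : n ≤ cL * L) (hK : n ≤ 3 * cK * Kp) (hI₁ : I₀ ≤ I₁ + 2 * e)
    (hI₁n : I₁ ≤ n) (hLn : L ≤ n) (hKn : Kp ≤ n)
    (hbox : I₁ * L * Kp ≤ G0 + e * (L * Kp) + e * (L * I₁) + e * (Kp * L)) (hG : G0 ≤ M)
    (he : 36 * (cI * cL * cK) * e ≤ n) (hcL : 1 ≤ cL) (hcK : 1 ≤ cK) :
    n ^ 3 ≤ 12 * (cI * cL * cK) * M := by
  have h4 : 4 * cI * e ≤ n := by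
    refine four_mul_le n e cI (cI * cL * cK) ?_ he
    calc cI = cI * 1 * 1 := by ring
      _ ≤ cI * cL * cK := Nat.mul_le_mul (Nat.mul_le_mul_left _ hcL) hcK
  have hI₁' : n ≤ 2 * cI * I₁ := le_two_mul n cI I₀ I₁ e hI hI₁ h4
  have h1 : n ^ 3 ≤ 6 * (cI * cL * cK) * (I₁ * L * Kp) := by
    calc n ^ 3 = n * n * n := by ring
      _ ≤ (2 * cI * I₁) * (cL * L) * (3 * cK * Kp) := Nat.mul_le_mul (Nat.mul_le_mul hI₁' hL) hK
      _ = 6 * (cI * cL * cK) * (I₁ * L * Kp) := by ring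
  have h2 : e * (L * Kp) + e * (L * I₁) + e * (Kp * L) ≤ 3 * (e * n ^ 2) := by
    have b1 := Nat.mul_le_mul_left e (Nat.mul_le_mul hLn hKn)
    have b2 := Nat.mul_le_mul_left e (Nat.mul_le_mul hLn hI₁n)
    have b3 := Nat.mul_le_mul_left e (Nat.mul_le_mul hKn hLn)
    nlinarith [b1, b2, b3]
  have h3 : 36 * (cI * cL * cK) * e * n ^ 2 ≤ n ^ 3 := by
    calc 36 * (cI * cL * cK) * e * n ^ 2 ≤ n * n ^ 2 := Nat.mul_le_mul_right _ he
      _ = n ^ 3 := by ring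
  have h5 : 6 * (cI * cL * cK) * (I₁ * L * Kp) ≤
      6 * (cI * cL * cK) * G0 + 6 * (cI * cL * cK) * (3 * (e * n ^ 2)) := by
    have h6 : I₁ * L * Kp ≤ G0 + 3 * (e * n ^ 2) := by omega
    have := Nat.mul_le_mul_left (6 * (cI * cL * cK)) h6
    nlinarith [this]
  have h6 : 6 * (cI * cL * cK) * G0 ≤ 6 * (cI * cL * cK) * M := Nat.mul_le_mul_left _ hG
  nlinarith [h1, h2, h3, h5, h6]

/-- Ending on a rectangle bound `n²·min(|I|, |𝓛|/2) ≤ 2M` with heavy `I` and `𝓛`, `|𝓛| ≥ 2`. -/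
theorem cube_le_of_min (n M I L cI cL : ℕ) (hI : n ≤ cI * I) (hL : n ≤ cL * L) (hL2 : 2 ≤ L)
    (hb : n ^ 2 * min I (L / 2) ≤ 2 * M) (hcI : 1 ≤ cI) (hcL : 1 ≤ cL) :
    n ^ 3 ≤ 6 * (cI * cL) * M := by
  have key : n ≤ 3 * (cI * cL) * min I (L / 2) := by
    rcases Nat.le_total I (L / 2) with h | h
    · rw [min_eq_left h]
      calc n ≤ cI * I := hI
        _ = 1 * (cI * 1) * I := by ring
        _ ≤ 3 * (cI * cL) * I :=
          Nat.mul_le_mul_right _ (Nat.mul_le_mul (by norm_num) (Nat.mul_le_mul_left _ hcL))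
    · rw [min_eq_right h]
      have hL3 : L ≤ 3 * (L / 2) := by omega
      calc n ≤ cL * L := hL
        _ ≤ cL * (3 * (L / 2)) := Nat.mul_le_mul_left _ hL3
        _ = 3 * (1 * cL) * (L / 2) := by ring
        _ ≤ 3 * (cI * cL) * (L / 2) :=
          Nat.mul_le_mul_right _ (Nat.mul_le_mul_left _ (Nat.mul_le_mul_right _ hcI))
  have h1 : n ^ 3 ≤ 3 * (cI * cL) * (n ^ 2 * min I (L / 2)) := by
    calc n ^ 3 = n ^ 2 * n := by ring
      _ ≤ n ^ 2 * (3 * (cI * cL) * min I (L / 2)) := Nat.mul_le_mul_left _ key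
      _ = 3 * (cI * cL) * (n ^ 2 * min I (L / 2)) := by ring
  have h2 := Nat.mul_le_mul_left (3 * (cI * cL)) hb
  nlinarith [h1, h2]

end BoxArith

variable {ι G : Type*} [AddCommGroup G]
variable {G₀ : Type*} [AddCommGroup G₀] {R : Type*}

open BoxArith in
/-- **THEOREM 8.19, numerical form (every chart, every class configuration).** A near-rectangle box
`I₀ × 𝓛 × K₀` (`a ≈ [v′]` on `I₀ × 𝓛`, `b ≈ [v]` on `𝓛 × K₀`, `≤ e` exceptions per line in both directions)
with heavy sides `n ≤ c_I|I₀|`, `n ≤ c_L|𝓛|`, `n ≤ c_K|K₀|` and `36·c_I c_L c_K·(e+1) ≤ n` forces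
`n³ ≤ 12·c_I c_L c_K · (r·|S⁰|)`. [this work §8.8 (T13); C3-m2 §5.5–5.7] -/
theorem Data.box_ending [Fintype ι] [DecidableEq ι] [Fintype G₀] [DecidableEq G₀] [Fintype R]
    [DecidableEq R] [DecidableEq G] (hG : ∀ x : G, x = -x → x = 0) (D : Data ι G) (Φ : Chart ι G₀)
    (κ : G → R) (hκ : ∀ x y, κ x = κ y → SignEq x y) (hsep : D.SepAll Φ) {v v' : G}
    (I₀ L K₀ : Finset ι) (e cI cL cK : ℕ)
    (hac : ∀ j ∈ L, ∃ E : Finset ι, E.card ≤ e ∧ ∀ i ∈ I₀, i ∉ E → SignEq (D.a i j) v')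
    (har : ∀ i ∈ I₀, ∃ E : Finset ι, E.card ≤ e ∧ ∀ j ∈ L, j ∉ E → SignEq (D.a i j) v')
    (hbr : ∀ j ∈ L, ∃ E : Finset ι, E.card ≤ e ∧ ∀ k ∈ K₀, k ∉ E → SignEq (D.b j k) v)
    (hbc : ∀ k ∈ K₀, ∃ E : Finset ι, E.card ≤ e ∧ ∀ j ∈ L, j ∉ E → SignEq (D.b j k) v)
    (hI : Fintype.card ι ≤ cI * I₀.card) (hL : Fintype.card ι ≤ cL * L.card)
    (hK : Fintype.card ι ≤ cK * K₀.card) (he : 36 * (cI * cL * cK) * (e + 1) ≤ Fintype.card ι) :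
    Fintype.card ι ^ 3 ≤ 12 * (cI * cL * cK) * (Fintype.card R * Fintype.card G₀) := by
  classical
  set n := Fintype.card ι with hn
  set M := Fintype.card R * Fintype.card G₀ with hM
  rcases Nat.eq_zero_or_pos n with h0 | hn1
  · simp [h0]
  have hcI : 1 ≤ cI := by
    rcases Nat.eq_zero_or_pos cI with h | h
    · rw [h, zero_mul] at hI; omega
    · exact h
  have hcL : 1 ≤ cL := by
    rcases Nat.eq_zero_or_pos cL with h | h
    · rw [h, zero_mul] at hL; omega
    · exact h
  have hcK : 1 ≤ cK := by
    rcases Nat.eq_zero_or_pos cK with h | h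
    · rw [h, zero_mul] at hK; omega
    · exact h
  obtain ⟨hCI, hCL, hCK⟩ := le_prod₃ cI cL cK hcI hcL hcK
  have he1 : cI * cL * cK * (36 * (e + 1)) ≤ n := by
    calc cI * cL * cK * (36 * (e + 1)) = 36 * (cI * cL * cK) * (e + 1) := by ring
      _ ≤ n := he
  have hLe : 36 * (e + 1) ≤ L.card := le_of_mul_le n cL _ _ _ hcL hCL hL he1
  have hIe : 36 * (e + 1) ≤ I₀.card := le_of_mul_le n cI _ _ _ hcI hCI hI he1
  have hKe : 36 * (e + 1) ≤ K₀.card := le_of_mul_le n cK _ _ _ hcK hCK hK he1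
  have he' : 36 * (cI * cL * cK) * e ≤ n :=
    le_trans (Nat.mul_le_mul_left _ (Nat.le_succ e)) he
  have h4 : 4 * cI * e ≤ n := four_mul_le n e cI _ hCI he'
  have hn2 : 2 ≤ n := le_trans (by omega) (hLe.trans (Finset.card_le_univ L))
  have hR : 0 < Fintype.card R := Fintype.card_pos_iff.2 ⟨κ 0⟩
  have hG0M : Fintype.card G₀ ≤ M := Nat.le_mul_of_pos_left _ hR
  -- the part `K_±` with `3c_K|K_±| ≥ n` has more than `2e` columns
  have hpart : ∀ Kp : Finset ι, n ≤ 3 * cK * Kp.card → 2 * e < Kp.card := by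
    intro Kp hKp
    have h3 : 3 * (cI * cL * cK) * (12 * (e + 1)) ≤ n := by
      calc 3 * (cI * cL * cK) * (12 * (e + 1)) = 36 * (cI * cL * cK) * (e + 1) := by ring
        _ ≤ n := he
    have := le_of_mul_le n (3 * cK) (3 * (cI * cL * cK)) (12 * (e + 1)) Kp.card (by omega)
      (by nlinarith [hCK]) hKp h3
    omega
  -- the box count ending on a pinned part
  have hbox_end : ∀ Kp : Finset ι, n ≤ 3 * cK * Kp.card →
      (2 * e < Kp.card → ∃ I₁ ⊆ I₀, I₀.card ≤ I₁.card + 2 * e ∧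
        I₁.card * L.card * Kp.card ≤ Fintype.card G₀ + e * (L.card * Kp.card) +
          e * (L.card * I₁.card) + e * (Kp.card * L.card)) →
      n ^ 3 ≤ 12 * (cI * cL * cK) * M := by
    intro Kp hKp hB
    obtain ⟨I₁, -, hI₀₁, hbox⟩ := hB (hpart Kp hKp)
    exact cube_le_of_part n M (Fintype.card G₀) I₀.card I₁.card L.card Kp.card e cI cL cK hI hL hKp
      hI₀₁ (Finset.card_le_univ _) (Finset.card_le_univ _) (Finset.card_le_univ _) hbox hG0M he' hcL hcK
  -- the rigid-rectangle ending on a zero-pinned part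
  have hzero_end : ∀ Kz : Finset ι, n ≤ 3 * cK * Kz.card →
      (2 * e < Kz.card → ∃ I₁ ⊆ I₀, I₀.card ≤ I₁.card + 2 * e ∧
        n ^ 2 * min I₁.card (n / 2) ≤ 2 * M) →
      n ^ 3 ≤ 12 * (cI * cL * cK) * M := by
    intro Kz hKz hZ
    obtain ⟨I₁, -, hI₀₁, hmin⟩ := hZ (hpart Kz hKz)
    have hI₁ : n ≤ 2 * cI * I₁.card := le_two_mul n cI I₀.card I₁.card e hI hI₀₁ h4
    have h := cube_le_of_min n M I₁.card n (2 * cI) 1 hI₁ (by omega) hn2 hmin (by omega) le_rfl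
    have h' : 6 * (2 * cI * 1) * M ≤ 12 * (cI * cL * cK) * M := by
      apply Nat.mul_le_mul_right
      nlinarith [hCI]
    exact h.trans h'
  have hz : ∀ {x : G}, SignEq x 0 → x = 0 := fun h => h.elim id fun h => h.trans neg_zero
  by_cases hv' : v' = 0
  · -- `a = 0` on the box: all rows of `b` agree on `K₀`, (T2a) on the whole of `K₀`
    subst hv'
    have hb := D.card_mul_le_of_a_nearZero Φ κ hκ hsep I₀ L K₀ e
      (fun j hj => by
        obtain ⟨E, hE, h⟩ := hac j hj
        exact ⟨E, hE, fun i hi hiE => hz (h i hi hiE)⟩)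
      (fun i hi => by
        obtain ⟨E, hE, h⟩ := har i hi
        exact ⟨E, hE, fun j hj hjE => hz (h j hj hjE)⟩)
      hbc (by omega) (by omega)
    exact cube_le_of_kc n M K₀.card L.card cI cL cK hL (by nlinarith [hK]) hb hcI
  by_cases hv : v = 0
  · -- `b = 0` on the box: `a` is column-class constant, the rectangle bound (T5)
    subst hv
    have hb := D.sq_mul_min_le_of_b_nearZero hG Φ κ hκ hsep I₀ L K₀ e
      (fun j hj => by
        obtain ⟨E, hE, h⟩ := hbr j hj
        exact ⟨E, hE, fun k hk hkE => hz (h k hk hkE)⟩)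
      (fun k hk => by
        obtain ⟨E, hE, h⟩ := hbc k hk
        exact ⟨E, hE, fun j hj hjE => hz (h j hj hjE)⟩)
      har (by omega) (by omega)
    have h := cube_le_of_min n M I₀.card L.card cI cL hI hL (by omega) hb hcI hcL
    have h' : 6 * (cI * cL) * M ≤ 12 * (cI * cL * cK) * M := by
      apply Nat.mul_le_mul_right
      nlinarith [hcK, Nat.zero_le (cI * cL)]
    exact h.trans h'
  by_cases hvv : SignEq v v'
  · -- `v ∼ v′`: `K₀ = K_c ⊔ K₊ ⊔ K_z`
    obtain ⟨Kc, -, Kp, -, Kz, -, hcard, hA, hB, hZ⟩ :=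
      D.nearRect_signEq hG Φ κ hκ hsep hv' hvv I₀ L K₀ e hac har hbr hbc (by omega)
    by_cases h1 : n ≤ 3 * cK * Kc.card
    · exact cube_le_of_kc n M Kc.card L.card cI cL cK hL h1 hA hcI
    by_cases h2 : n ≤ 3 * cK * Kp.card
    · exact hbox_end Kp h2 hB
    exact hzero_end Kz (third_heavy n cK K₀.card Kc.card Kp.card Kz.card hK hcard h1 h2) hZ
  · -- generic classes: `K₀ = K_c ⊔ K₊ ⊔ K₋`
    obtain ⟨Kc, -, Kp, -, Km, -, hcard, hA, hB, hC⟩ :=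
      D.nearRect hG Φ κ hκ hsep hv hv' hvv I₀ L K₀ e hac har hbr hbc (by omega)
    by_cases h1 : n ≤ 3 * cK * Kc.card
    · exact cube_le_of_kc n M Kc.card L.card cI cL cK hL h1 hA hcI
    by_cases h2 : n ≤ 3 * cK * Kp.card
    · exact hbox_end Kp h2 hB
    exact hbox_end Km (third_heavy n cK K₀.card Kc.card Kp.card Km.card hK hcard h1 h2) hC

end FibreLines

end Summit.MatrixMultiplication.MatrixMultiplication.Theorems.TwistedTPP
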